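import Summits.HubbardSuperconductivity.HubbardSuperconductivity.Theses.KkFloor
import Literature.Analysis.Matrix.SpectralAbscissaPencil
import Literature.Analysis.Potential.HalfPlanePoissonBoundary
import Literature.MathematicalPhysics.QuantumLattice.SectorSpectrum

/-!
# Route `KkFloor` — `KkFloorTheorem` (stmt-HubbardSuperconductivity-10406), the Kramers–Kronig floor

The item: for a Hermitian `A`, a positive semidefinite Hermitian `B`, a subspace `V` invariant under
both, `E` below the Rayleigh quotient of `A` on unit vectors of `V`, a unit `ψ ∈ V` with `Aψ = Eψ`,
a set `S ⊆ ℝ` and ANY profile `d` with `E + d(y) ≤ Re λ` for every eigenpair `(λ, v)`, `v ∈ V ∖ 0`,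
of `A + iyB`, `y ∈ S`: `∫⁻_S d(y) y⁻² dy ≤ π · Re⟨ψ, Bψ⟩`.

* `kkFloor_core` — the case `V = ℂⁿ` (classical potential theory, as in the item's sketch):
  `U(z) := log ρ(exp(-(A + zB)))` is subharmonic on `ℂ` and under holomorphic reparametrisation
  (Vesentini, `isSubharmonicOn_log_spectralRadius_exp_pencil`) and equals minus the spectral
  abscissa of `A + zB` (`neg_re_le_log_spectralRadius_exp`, `log_spectralRadius_exp_le`); the
  numerical range gives `U ≤ -E` on `Re z ≥ 0`, the Rayleigh quotient at `ψ` gives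
  `U(x) ≥ -(E + x⟨ψ,Bψ⟩)` for `x > 0`, and the hypothesis gives `U(iy) ≤ -(E + d(y))` on `S`; the
  half-plane Poisson boundary bound `Literature.Analysis.Potential.lintegral_boundary_le_of_subharmonic`
  applied to `u = U + E` yields `∫ (-u(iy)) y⁻² dy ≤ π⟨ψ,Bψ⟩`, and `d ≤ -u(i·)` on `S` finishes
  (for arbitrary, possibly non-measurable `S` and `d`, through the supremum-of-simple-functions
  definition of `∫⁻`, `setLIntegral_le_lintegral_of_forall_mem`).
* `kkFloorTheorem_proof` — the item: isometric coordinates on `V` by an orthonormal basis of its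
  Euclidean copy (`stdOrthonormalBasis`) turn `A|_V`, `B|_V` into a Hermitian and a positive
  semidefinite matrix on `Fin k`, `ψ` into a unit eigenvector, and eigenvectors of `A' + iyB'` into
  eigenvectors in `V`; apply `kkFloor_core`.

With this file the deciding theorem `KkFloor.closes` of the route is hinged on the physics crux
`KkBandLift` alone. Sources: T. Ransford, *Potential Theory in the Complex Plane* (1995), Thm 6.4.2
(Vesentini) and §2.4; T. Kato (1966) II-§2.3.
-/

set_option linter.dupNamespace false

noncomputable section

namespace Summit.HubbardSuperconductivity.HubbardSuperconductivity.Theorems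

open Matrix Complex MeasureTheory Set Filter
open scoped ENNReal ComplexOrder InnerProductSpace
open Literature.Analysis.Matrix Literature.Analysis.Pluripotential
open Literature.MathematicalPhysics.QuantumLattice

variable {n : Type*} [Fintype n] [DecidableEq n]

/-- A point of the spectrum of a complex matrix has a unit eigenvector. [folklore] -/
theorem exists_unit_eigenvector_of_mem_spectrum (M : Matrix n n ℂ) {lam : ℂ}
    (h : lam ∈ spectrum ℂ M) : ∃ v : n → ℂ, star v ⬝ᵥ v = 1 ∧ M *ᵥ v = lam • v := by
  have hs : spectrum ℂ (Matrix.toLin' M) = spectrum ℂ M :=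
    AlgEquiv.spectrum_eq (Matrix.toLinAlgEquiv' : Matrix n n ℂ ≃ₐ[ℂ] _) M
  have h' : lam ∈ spectrum ℂ (Matrix.toLin' M) := by rwa [hs]
  rw [← Module.End.hasEigenvalue_iff_mem_spectrum] at h'
  obtain ⟨v, hv⟩ := h'.exists_hasEigenvector
  have hv0 : v ≠ 0 := hv.2
  have hMv : M *ᵥ v = lam • v := by
    have := Module.End.mem_eigenspace_iff.mp hv.1
    rwa [Matrix.toLin'_apply] at this
  obtain ⟨c, hc, hc1⟩ := exists_smul_unit hv0
  exact ⟨c • v, hc1, by rw [mulVec_smul, hMv, smul_comm]⟩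

omit [DecidableEq n] in
/-- Real part of an eigenvalue of `A + wB` through the numerical range: if `v` is a unit
eigenvector for `λ`, then `Re λ = Re⟨v,Av⟩ + Re w · ⟨v,Bv⟩` (`B` Hermitian). [folklore] -/
theorem re_eigenvalue_eq (A B : Matrix n n ℂ) (hB : B.IsHermitian) (w lam : ℂ)
    (v : n → ℂ) (hv1 : star v ⬝ᵥ v = 1) (hv : (A + w • B) *ᵥ v = lam • v) :
    lam.re = (star v ⬝ᵥ A *ᵥ v).re + w.re * (star v ⬝ᵥ B *ᵥ v).re := by
  have h1 : star v ⬝ᵥ (A + w • B) *ᵥ v = lam := by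
    rw [hv, dotProduct_smul, hv1, smul_eq_mul, mul_one]
  rw [add_mulVec, dotProduct_add, smul_mulVec, dotProduct_smul, smul_eq_mul] at h1
  have hBreal : (star v ⬝ᵥ B *ᵥ v).im = 0 := hB.im_star_dotProduct_mulVec_self v
  rw [← h1, Complex.add_re, Complex.mul_re, hBreal, mul_zero, sub_zero]

omit [DecidableEq n] in
/-- For an arbitrary set `S` and arbitrary `f`, a measurable majorant `g ≥ f` ON `S` bounds the
restricted lower Lebesgue integral: `∫⁻_{S} f ≤ ∫⁻ g` (supremum over simple minorants; no
measurability of `S` or `f` is needed). [folklore] -/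
theorem setLIntegral_le_lintegral_of_forall_mem {f g : ℝ → ℝ≥0∞} (S : Set ℝ) (hg : Measurable g)
    (h : ∀ y ∈ S, f y ≤ g y) : ∫⁻ y in S, f y ≤ ∫⁻ y, g y := by
  rw [lintegral_eq_nnreal]
  refine iSup₂_le fun φ hφ => ?_
  set T : Set ℝ := {y | ((φ y : NNReal) : ℝ≥0∞) ≤ g y} with hT
  have hTm : MeasurableSet T :=
    measurableSet_le (φ.measurable.coe_nnreal_ennreal) hg
  have hST : S ⊆ T := fun y hy => (hφ y).trans (h y hy)
  rw [← SimpleFunc.lintegral_eq_lintegral]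
  calc ∫⁻ y in S, (φ.map ((↑) : NNReal → ℝ≥0∞)) y
      ≤ ∫⁻ y in T, (φ.map ((↑) : NNReal → ℝ≥0∞)) y :=
        lintegral_mono' (Measure.restrict_mono hST le_rfl) le_rfl
    _ ≤ ∫⁻ y in T, g y := setLIntegral_mono' hTm fun y hy => hy
    _ ≤ ∫⁻ y, g y := lintegral_mono' Measure.restrict_le_self le_rfl

/-- **The Kramers–Kronig floor, core matrix form** (`V = ℂⁿ`). See the module docstring.
[folklore] -/
theorem kkFloor_core [Nonempty n] (A B : Matrix n n ℂ) (hA : A.IsHermitian) (hB : B.IsHermitian)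
    (hBpos : ∀ v : n → ℂ, 0 ≤ (star v ⬝ᵥ B *ᵥ v).re) (E : ℝ) (S : Set ℝ) (d : ℝ → ℝ)
    (ψ : n → ℂ) (hE : ∀ v : n → ℂ, star v ⬝ᵥ v = 1 → E ≤ (star v ⬝ᵥ A *ᵥ v).re)
    (hψ1 : star ψ ⬝ᵥ ψ = 1) (hAψ : A *ᵥ ψ = (E : ℂ) • ψ)
    (hd : ∀ y ∈ S, ∀ v : n → ℂ, v ≠ 0 → ∀ lam : ℂ,
      (A + (Complex.I * (y : ℂ)) • B) *ᵥ v = lam • v → E + d y ≤ lam.re) :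
    ∫⁻ y in S, ENNReal.ofReal (d y / y ^ 2) ≤
      ENNReal.ofReal (Real.pi * (star ψ ⬝ᵥ B *ᵥ ψ).re) := by
  -- the subharmonic function `u = log ρ(exp(-(A + zB))) + E`
  set U : ℂ → EReal := fun z => ENNReal.log (spectralRadius ℂ (NormedSpace.exp (-(A + z • B))))
    with hU_def
  set u : ℂ → EReal := fun z => U z + ((E : ℝ) : EReal) with hu_def
  set β : ℝ := (star ψ ⬝ᵥ B *ᵥ ψ).re with hβ_def
  -- eigenvalues of `A + wB` have real part `≥ E` for `Re w ≥ 0`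
  have hspecE : ∀ w : ℂ, 0 ≤ w.re → ∀ lam ∈ spectrum ℂ (A + w • B), E ≤ lam.re := by
    intro w hw lam hlam
    obtain ⟨v, hv1, hv⟩ := exists_unit_eigenvector_of_mem_spectrum _ hlam
    rw [re_eigenvalue_eq A B hB w lam v hv1 hv]
    nlinarith [hE v hv1, hBpos v, mul_nonneg hw (hBpos v)]
  -- on `S` they have real part `≥ E + d`
  have hspecS : ∀ y ∈ S, ∀ lam ∈ spectrum ℂ (A + (Complex.I * (y : ℂ)) • B), E + d y ≤ lam.re := by
    intro y hy lam hlam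
    obtain ⟨v, hv1, hv⟩ := exists_unit_eigenvector_of_mem_spectrum _ hlam
    have hv0 : v ≠ 0 := by
      intro h0; rw [h0, dotProduct_zero] at hv1; exact zero_ne_one hv1
    exact hd y hy v hv0 lam hv
  -- (u0) `u ≤ 0` on the closed right half-plane
  have hu0 : ∀ z : ℂ, 0 ≤ z.re → u z ≤ 0 := by
    intro z hz
    have h := log_spectralRadius_exp_le A B z E (hspecE z hz)
    simp only [hu_def]
    calc U z + ((E : ℝ) : EReal) ≤ ((-E : ℝ) : EReal) + ((E : ℝ) : EReal) := add_le_add h le_rfl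
      _ = 0 := by rw [← EReal.coe_add]; simp
  -- (ux) `u(x) ≥ -xβ` for `x > 0`
  have hux : ∀ x : ℝ, 0 < x → ((-(x * β) : ℝ) : EReal) ≤ u x := by
    intro x hx
    -- the Hermitian matrix `A + xB`, its ground energy is an eigenvalue below the Rayleigh quotient
    set T : Matrix n n ℂ := A + (x : ℂ) • B with hT
    have hTh : T.IsHermitian := by
      refine hA.add ?_
      unfold Matrix.IsHermitian
      rw [conjTranspose_smul, hB.eq, Complex.star_def, Complex.conj_ofReal]
    obtain ⟨v, hvmem, hv0⟩ := (Submodule.ne_bot_iff _).1 (Matrix.groundSpace_ne_bot_holds hTh)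
    rw [Matrix.mem_groundSpace_iff] at hvmem
    have hE0spec : ((T.groundEnergy : ℝ) : ℂ) ∈ spectrum ℂ (A + (x : ℂ) • B) := by
      rw [← AlgEquiv.spectrum_eq (Matrix.toLinAlgEquiv' : Matrix n n ℂ ≃ₐ[ℂ] _),
        ← Module.End.hasEigenvalue_iff_mem_spectrum]
      refine Module.End.hasEigenvalue_of_hasEigenvector (x := v) ⟨?_, hv0⟩
      rw [Module.End.mem_eigenspace_iff]
      show Matrix.toLin' T v = _
      rw [Matrix.toLin'_apply, hvmem]
    have hray := Matrix.groundEnergy_le_rayleigh_holds hTh ψ hψ1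
    have hrayval : (star ψ ⬝ᵥ T *ᵥ ψ).re = E + x * β := by
      simp only [hT, add_mulVec, dotProduct_add, smul_mulVec, dotProduct_smul, smul_eq_mul,
        Complex.add_re, Complex.mul_re, Complex.ofReal_re, Complex.ofReal_im, zero_mul, sub_zero, hAψ]
      rw [hψ1]
      simp [hβ_def]
    have hlow := neg_re_le_log_spectralRadius_exp A B (x : ℂ) hE0spec
    simp only [Complex.ofReal_re] at hlow
    simp only [hu_def]
    calc ((-(x * β) : ℝ) : EReal) = ((-(E + x * β) : ℝ) : EReal) + ((E : ℝ) : EReal) := by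
          rw [← EReal.coe_add]; congr 1; ring
      _ ≤ ((-T.groundEnergy : ℝ) : EReal) + ((E : ℝ) : EReal) := by
          refine add_le_add (EReal.coe_le_coe_iff.mpr ?_) le_rfl
          linarith
      _ ≤ U x + ((E : ℝ) : EReal) := add_le_add hlow le_rfl
  -- (usub) subharmonicity of the Cayley pull-backs
  have husub : ∀ x : ℝ, 0 < x →
      IsSubharmonicOn (fun ζ => u ((x : ℂ) * ((1 + ζ) / (1 - ζ)))) {ζ | ζ ≠ 1} := by
    intro x hx
    have hg : DifferentiableOn ℂ (fun ζ : ℂ => (x : ℂ) * ((1 + ζ) / (1 - ζ))) {ζ | ζ ≠ 1} := by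
      intro ζ hζ
      refine (DifferentiableAt.const_mul ?_ _).differentiableWithinAt
      refine ((differentiableAt_const _).add differentiableAt_id).div
        ((differentiableAt_const _).sub differentiableAt_id) ?_
      exact sub_ne_zero.mpr (Ne.symm hζ)
    have h1 := isSubharmonicOn_log_spectralRadius_exp_pencil A B isOpen_ne hg
    have h2 := h1.add (isSubharmonicOn_const E {ζ : ℂ | ζ ≠ 1})
    exact h2
  -- (umeas) measurability of the boundary trace
  have humeas : Measurable fun y : ℝ => u (Complex.I * y) := by
    have h1 := isSubharmonicOn_log_spectralRadius_exp_pencil A B isOpen_univ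
      (differentiable_id.differentiableOn : DifferentiableOn ℂ (fun z : ℂ => z) univ)
    have husc : UpperSemicontinuous U := by
      rw [← upperSemicontinuousOn_univ_iff]
      exact h1.1
    have husc' : UpperSemicontinuous fun y : ℝ => U (Complex.I * y) :=
      husc.comp (continuous_const.mul Complex.continuous_ofReal)
    have hm : Measurable fun y : ℝ => U (Complex.I * y) := husc'.measurable
    exact hm.add measurable_const
  -- the half-plane bound
  have hmain := Literature.Analysis.Potential.lintegral_boundary_le_of_subharmonic u β hu0 hux husub humeas
  -- `d ≤ -u(i·)` on `S`
  have hdom : ∀ y ∈ S, ENNReal.ofReal (d y / y ^ 2) ≤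
      (-u (Complex.I * ((y : ℝ) : ℂ))).toENNReal * ENNReal.ofReal (1 / y ^ 2) := by
    intro y hy
    have hUS := log_spectralRadius_exp_le A B (Complex.I * (y : ℂ)) (E + d y) (hspecS y hy)
    have hneg : ((d y : ℝ) : EReal) ≤ -u (Complex.I * y) := by
      simp only [hu_def]
      -- -(U + E) ≥ d y  ⟸  U ≤ -(E + d y)
      have : U (Complex.I * (y : ℂ)) + ((E : ℝ) : EReal) ≤ ((-(E + d y) : ℝ) : EReal) + ((E : ℝ) : EReal) :=
        add_le_add hUS le_rfl
      rw [← EReal.coe_add, show -(E + d y) + E = -d y by ring, EReal.coe_neg] at this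
      simpa using EReal.neg_le_neg_iff.mpr this
    have hto : ENNReal.ofReal (d y) ≤ (-u (Complex.I * y)).toENNReal :=
      (EReal.real_coe_toENNReal (d y)).symm.le.trans (EReal.toENNReal_le_toENNReal hneg)
    by_cases hy0 : y = 0
    · simp [hy0]
    rcases le_or_gt (d y) 0 with hdy | hdy
    · rw [ENNReal.ofReal_of_nonpos (div_nonpos_of_nonpos_of_nonneg hdy (sq_nonneg y))]
      exact bot_le
    · rw [div_eq_mul_one_div, ENNReal.ofReal_mul hdy.le]
      exact mul_le_mul' hto le_rfl
  have hmeasG : Measurable fun y : ℝ =>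
      (-u (Complex.I * ((y : ℝ) : ℂ))).toENNReal * ENNReal.ofReal (1 / y ^ 2) := by
    refine humeas.neg.ereal_toENNReal.mul (ENNReal.measurable_ofReal.comp ?_)
    exact (measurable_const (a := (1 : ℝ))).div (measurable_id.pow_const 2)
  calc ∫⁻ y in S, ENNReal.ofReal (d y / y ^ 2)
      ≤ ∫⁻ y : ℝ, (-u (Complex.I * ((y : ℝ) : ℂ))).toENNReal * ENNReal.ofReal (1 / y ^ 2) :=
        setLIntegral_le_lintegral_of_forall_mem S hmeasG hdom
    _ ≤ ENNReal.ofReal (Real.pi * β) := hmain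


/-- A matrix whose sesquilinear form is conjugate-symmetric is Hermitian. [folklore] -/
theorem isHermitian_of_forall_star_dotProduct_mulVec {m : Type*} [Fintype m] [DecidableEq m]
    (M : Matrix m m ℂ) (h : ∀ x y : m → ℂ, star x ⬝ᵥ M *ᵥ y = star (star y ⬝ᵥ M *ᵥ x)) :
    M.IsHermitian := by
  refine Matrix.IsHermitian.ext fun i j => ?_
  have h1 := h (Pi.single i 1) (Pi.single j 1)
  have hs : ∀ l : m, star (Pi.single l (1 : ℂ) : m → ℂ) = Pi.single l 1 := fun l => by
    ext a
    simp only [Pi.star_apply, Pi.single_apply]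
    split_ifs <;> simp
  rw [hs, hs, mulVec_single_one, mulVec_single_one, single_one_dotProduct,
    single_one_dotProduct] at h1
  simpa [Matrix.col_apply] using h1.symm

/-- For a Hermitian matrix, `⟨x, M y⟩ = conj ⟨y, M x⟩`. [folklore] -/
theorem star_dotProduct_mulVec_comm_of_isHermitian {m : Type*} [Fintype m]
    {M : Matrix m m ℂ} (hM : M.IsHermitian) (x y : m → ℂ) :
    star x ⬝ᵥ M *ᵥ y = star (star y ⬝ᵥ M *ᵥ x) := by
  conv_rhs => rw [star_dotProduct, star_star, star_mulVec, ← dotProduct_mulVec, hM.eq]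

/-- **`KkFloorTheorem`** (route `KkFloor`, item `stmt-HubbardSuperconductivity-10406`; the
Kramers–Kronig floor in an invariant subspace). See the module docstring: isometric coordinates
on `V` by an orthonormal basis, then `kkFloor_core`. [cite: Ransford1995, Thm 6.4.2] -/
theorem kkFloorTheorem_proof :
    Summit.HubbardSuperconductivity.HubbardSuperconductivity.Theses.KkFloor.KkFloorTheorem := by
  intro n _ _ A B V E S d ψ hA hB hBpos hAV hBV hE hψV hψ1 hAψ hd
  classical
  -- the Euclidean copy of `V` and an orthonormal basis
  set eN : (n → ℂ) ≃ₗ[ℂ] EuclideanSpace ℂ n := (WithLp.linearEquiv 2 ℂ (n → ℂ)).symm with heN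
  have heN_apply : ∀ v, eN v = WithLp.toLp 2 v := fun v => rfl
  set V' : Submodule ℂ (EuclideanSpace ℂ n) := V.map eN.toLinearMap with hV'
  have hmemV' : ∀ v, v ∈ V → WithLp.toLp 2 v ∈ V' := fun v hv =>
    Submodule.mem_map_of_mem (f := eN.toLinearMap) hv
  have hmemV : ∀ x : EuclideanSpace ℂ n, x ∈ V' → WithLp.ofLp x ∈ V := by
    intro x hx
    obtain ⟨v, hv, rfl⟩ := Submodule.mem_map.mp hx
    exact hv
  set k : ℕ := Module.finrank ℂ V' with hk
  set b : OrthonormalBasis (Fin k) ℂ V' := stdOrthonormalBasis ℂ V' with hb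
  -- coordinate map and lift, as linear maps
  set eK : (Fin k → ℂ) ≃ₗ[ℂ] EuclideanSpace ℂ (Fin k) := (WithLp.linearEquiv 2 ℂ (Fin k → ℂ)).symm
    with heK
  set P : EuclideanSpace ℂ n →ₗ[ℂ] V' :=
    (V'.orthogonalProjectionOnto : EuclideanSpace ℂ n →L[ℂ] V').toLinearMap with hP
  set cL : (n → ℂ) →ₗ[ℂ] (Fin k → ℂ) :=
    eK.symm.toLinearMap ∘ₗ b.repr.toLinearEquiv.toLinearMap ∘ₗ P ∘ₗ eN.toLinearMap with hcL
  set liftL : (Fin k → ℂ) →ₗ[ℂ] (n → ℂ) :=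
    eN.symm.toLinearMap ∘ₗ V'.subtype ∘ₗ b.repr.symm.toLinearEquiv.toLinearMap ∘ₗ eK.toLinearMap
    with hliftL
  have hcL_apply : ∀ v : n → ℂ, cL v = WithLp.ofLp (b.repr (P (WithLp.toLp 2 v))) := fun v => rfl
  have hliftL_apply : ∀ x : Fin k → ℂ,
      liftL x = WithLp.ofLp ((b.repr.symm (WithLp.toLp 2 x) : V') : EuclideanSpace ℂ n) :=
    fun x => rfl
  have hP_mem : ∀ v : n → ℂ, ∀ hv : v ∈ V, P (WithLp.toLp 2 v) = ⟨WithLp.toLp 2 v, hmemV' v hv⟩ :=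
    fun v hv => Submodule.orthogonalProjectionOnto_mem_subspace_eq_self (⟨WithLp.toLp 2 v, hmemV' v hv⟩ : V')
  have hPv : ∀ v : V', P (v : EuclideanSpace ℂ n) = v := fun v => by
    rw [hP, ContinuousLinearMap.coe_coe]
    exact Submodule.orthogonalProjectionOnto_mem_subspace_eq_self v
  -- dictionary
  have hlift_mem : ∀ x, liftL x ∈ V := fun x => hmemV _ (b.repr.symm (WithLp.toLp 2 x)).2
  have hc_lift : ∀ x, cL (liftL x) = x := by
    intro x
    rw [hcL_apply, hliftL_apply, WithLp.toLp_ofLp, hPv]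
    simp
  have hlift_c : ∀ v ∈ V, liftL (cL v) = v := by
    intro v hv
    rw [hliftL_apply, hcL_apply, WithLp.toLp_ofLp, LinearIsometryEquiv.symm_apply_apply, hP_mem v hv]
  have hiso : ∀ v ∈ V, ∀ w ∈ V, star (cL v) ⬝ᵥ cL w = star v ⬝ᵥ w := by
    intro v hv w hw
    rw [hcL_apply, hcL_apply, hP_mem v hv, hP_mem w hw]
    have h1 : ∀ a c : EuclideanSpace ℂ (Fin k), star (WithLp.ofLp a) ⬝ᵥ WithLp.ofLp c = ⟪a, c⟫_ℂ :=
      fun a c => by rw [EuclideanSpace.inner_eq_star_dotProduct, dotProduct_comm]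
    rw [h1, LinearIsometryEquiv.inner_map_map, Submodule.coe_inner]
    show ⟪WithLp.toLp 2 v, WithLp.toLp 2 w⟫_ℂ = _
    rw [EuclideanSpace.inner_toLp_toLp, dotProduct_comm]
  have hiso' : ∀ x z : Fin k → ℂ, star x ⬝ᵥ z = star (liftL x) ⬝ᵥ liftL z := by
    intro x z
    conv_lhs => rw [← hc_lift x, ← hc_lift z]
    exact hiso _ (hlift_mem x) _ (hlift_mem z)
  have hc_inj : ∀ v ∈ V, ∀ w ∈ V, cL v = cL w → v = w := by
    intro v hv w hw h
    rw [← hlift_c v hv, ← hlift_c w hw, h]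
  -- the restricted matrices
  set A' : Matrix (Fin k) (Fin k) ℂ := LinearMap.toMatrix' (cL ∘ₗ Matrix.toLin' A ∘ₗ liftL) with hA'
  set B' : Matrix (Fin k) (Fin k) ℂ := LinearMap.toMatrix' (cL ∘ₗ Matrix.toLin' B ∘ₗ liftL) with hB'
  have hA'mul : ∀ x, A' *ᵥ x = cL (A *ᵥ liftL x) := fun x => by
    rw [hA', LinearMap.toMatrix'_mulVec]; rfl
  have hB'mul : ∀ x, B' *ᵥ x = cL (B *ᵥ liftL x) := fun x => by
    rw [hB', LinearMap.toMatrix'_mulVec]; rfl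
  -- quadratic forms transfer
  have hformA : ∀ x z : Fin k → ℂ, star x ⬝ᵥ A' *ᵥ z = star (liftL x) ⬝ᵥ A *ᵥ liftL z := by
    intro x z
    rw [hA'mul]
    conv_lhs => rw [← hc_lift x]
    exact hiso _ (hlift_mem x) _ (hAV _ (hlift_mem z))
  have hformB : ∀ x z : Fin k → ℂ, star x ⬝ᵥ B' *ᵥ z = star (liftL x) ⬝ᵥ B *ᵥ liftL z := by
    intro x z
    rw [hB'mul]
    conv_lhs => rw [← hc_lift x]
    exact hiso _ (hlift_mem x) _ (hBV _ (hlift_mem z))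
  have hA'h : A'.IsHermitian := isHermitian_of_forall_star_dotProduct_mulVec A' fun x z => by
    rw [hformA, hformA, star_dotProduct_mulVec_comm_of_isHermitian hA]
  have hB'h : B'.IsHermitian := isHermitian_of_forall_star_dotProduct_mulVec B' fun x z => by
    rw [hformB, hformB, star_dotProduct_mulVec_comm_of_isHermitian hB]
  have hB'pos : ∀ x : Fin k → ℂ, 0 ≤ (star x ⬝ᵥ B' *ᵥ x).re := fun x => by
    rw [hformB]; exact hBpos _
  have hE' : ∀ x : Fin k → ℂ, star x ⬝ᵥ x = 1 → E ≤ (star x ⬝ᵥ A' *ᵥ x).re := by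
    intro x hx
    rw [hformA]
    refine hE _ (hlift_mem x) ?_
    rw [← hiso' x x, hx]
  -- the transported eigenvector
  set ψ' : Fin k → ℂ := cL ψ with hψ'
  have hψ'1 : star ψ' ⬝ᵥ ψ' = 1 := by rw [hψ', hiso ψ hψV ψ hψV, hψ1]
  have hAψ' : A' *ᵥ ψ' = (E : ℂ) • ψ' := by
    rw [hA'mul, hψ', hlift_c ψ hψV, hAψ, map_smul]
  -- eigenvectors of `A' + iyB'` are coordinates of eigenvectors in `V`
  have hd' : ∀ y ∈ S, ∀ x : Fin k → ℂ, x ≠ 0 → ∀ lam : ℂ,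
      (A' + (Complex.I * (y : ℂ)) • B') *ᵥ x = lam • x → E + d y ≤ lam.re := by
    intro y hy x hx lam heq
    set v := liftL x with hv
    have hvV : v ∈ V := hlift_mem x
    have hv0 : v ≠ 0 := by
      intro h0
      apply hx
      rw [← hc_lift x, ← hv, h0, map_zero]
    have hmem : (A + (Complex.I * (y : ℂ)) • B) *ᵥ v ∈ V := by
      rw [add_mulVec, smul_mulVec]
      exact V.add_mem (hAV v hvV) (V.smul_mem _ (hBV v hvV))
    have hcoord : cL ((A + (Complex.I * (y : ℂ)) • B) *ᵥ v) = cL (lam • v) := by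
      rw [add_mulVec, smul_mulVec, map_add, map_smul, map_smul, ← hA'mul, ← hB'mul, hc_lift x,
        ← heq, add_mulVec, smul_mulVec]
    have heqV := hc_inj _ hmem _ (V.smul_mem lam hvV) hcoord
    exact hd y hy v hvV hv0 lam heqV
  -- nonempty index type
  have hk0 : 0 < k := by
    rw [hk, Module.finrank_pos_iff_exists_ne_zero]
    refine ⟨⟨WithLp.toLp 2 ψ, hmemV' ψ hψV⟩, fun h0 => ?_⟩
    have h1 : WithLp.toLp 2 ψ = (0 : EuclideanSpace ℂ n) := congrArg Subtype.val h0
    have h2 : ψ = 0 := by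
      have := congrArg WithLp.ofLp h1
      simpa using this
    rw [h2, dotProduct_zero] at hψ1
    exact zero_ne_one hψ1
  haveI : Nonempty (Fin k) := ⟨⟨0, hk0⟩⟩
  -- apply the core
  have hcore := kkFloor_core A' B' hA'h hB'h hB'pos E S d ψ' hE' hψ'1 hAψ' hd'
  have hβ : (star ψ' ⬝ᵥ B' *ᵥ ψ').re = (star ψ ⬝ᵥ B *ᵥ ψ).re := by
    rw [hformB, hψ', hlift_c ψ hψV]
  rw [hβ] at hcore
  exact hcore


end Summit.HubbardSuperconductivity.HubbardSuperconductivity.Theorems
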